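import Mathlib
import HarnessLib

/-!
# Cyclotomic dictionary at `2` for `σ : ℂ ≃ₐ[ℚ] ℂ` with `σ(e^{2πi/N}) = (e^{2πi/N})^d`: the values `σ(i)` and `σ(√2)`
(route `ManinLocalTwoThree`, crux C2 `ManinOddAtFour` stmt-BirchSwinnertonDyer-22967; cell bsd-f2-manin, C2/C3 LEAD p1 gen 19;
`--supports stmt-BirchSwinnertonDyer-22967`; D5→D6 bridge of E-es-185: the quadratic characters of conductor `4` and `8` —
`d ↦ σ_d(i)/i = χ₋₄(d)`, `d ↦ σ_d(√2)/√2 = χ₈(d)` — i.e. the square classes `−1, 2` (and `−2`) that MEMO-es §59.5 STEP 2 matches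
with the Kummer classes of `δ(R_{2^a})`; together with `ComplexAut.sqClass_eq_of_forall_kummer_eq`)

* `algEquiv_I_eq_I_pow` — `4 ∣ N` ⟹ `σ i = i^d`; `algEquiv_I_of_mod_four_eq_one/three` — `= i` resp. `−i`.
* `algEquiv_sqrt_two_of_mod_eight` — `8 ∣ N` ⟹ `σ √2 = √2` if `d ≡ ±1 (mod 8)`, `σ √2 = −√2` if `d ≡ ±3 (mod 8)`
  (`√2 = ζ₈ + ζ₈⁷`, `ζ₈ = (e^{2πi/N})^{N/8}`).

Elementary (Euler, de Moivre); nothing about C2, Manin's conjecture or BSD is proved here.  [folklore]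
-/

set_option autoImplicit false
-- lint-debt: the directory name repeats the summit name (sibling precedent `ManinLocalTwoThreeComplexAutExtension.lean`)
set_option linter.dupNamespace false

noncomputable section

open Complex

namespace Summit.BirchSwinnertonDyer.BirchSwinnertonDyer.Theorems.ManinLocalTwoThree.ComplexAut

/-! ## §1 Powers of `ζ_N = e^{2πi/N}` -/

/-- `(e^{2πi/N})^m = e^{2πi m/N}`. [folklore] -/
theorem exp_two_pi_I_div_pow (N m : ℕ) :
    exp (2 * Real.pi * I / N) ^ m = exp (2 * Real.pi * I * m / N) := by
  rw [← exp_nat_mul]; congr 1; ring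

/-- If `N = 4m` then `(e^{2πi/N})^m = i`. [folklore] -/
theorem exp_two_pi_I_div_pow_eq_I {N m : ℕ} (hN : N = 4 * m) (hm : m ≠ 0) :
    exp (2 * Real.pi * I / N) ^ m = I := by
  rw [exp_two_pi_I_div_pow]
  have hm' : (m : ℂ) ≠ 0 := by exact_mod_cast hm
  have h : (2 * Real.pi * I * m / N : ℂ) = Real.pi / 2 * I := by
    rw [hN]; push_cast; field_simp; ring
  rw [h, exp_pi_div_two_mul_I]

/-- If `N = 8m` then `(e^{2πi/N})^m = e^{πi/4} = ζ₈`. [folklore] -/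
theorem exp_two_pi_I_div_pow_eq_zeta_eight {N m : ℕ} (hN : N = 8 * m) (hm : m ≠ 0) :
    exp (2 * Real.pi * I / N) ^ m = exp (Real.pi / 4 * I) := by
  rw [exp_two_pi_I_div_pow]
  congr 1
  have hm' : (m : ℂ) ≠ 0 := by exact_mod_cast hm
  rw [hN]; push_cast
  field_simp
  ring

/-! ## §2 `σ(i)` -/

/-- **Conductor 4.**  If `4 ∣ N` and `σ(ζ_N) = ζ_N^d` then `σ(i) = i^d`. [folklore] -/
theorem algEquiv_I_eq_I_pow (σ : ℂ ≃ₐ[ℚ] ℂ) {N d : ℕ} (hN : N ≠ 0) (h4 : 4 ∣ N)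
    (hσ : σ (exp (2 * Real.pi * I / N)) = exp (2 * Real.pi * I / N) ^ d) : σ I = I ^ d := by
  obtain ⟨m, rfl⟩ := h4
  have hm : m ≠ 0 := by rintro rfl; exact hN rfl
  have hI := exp_two_pi_I_div_pow_eq_I (N := 4 * m) rfl hm
  rw [← hI, map_pow, hσ, ← pow_mul, Nat.mul_comm d m, pow_mul, hI]

/-- `i^d = i` for `d ≡ 1 (mod 4)` and `i^d = −i` for `d ≡ 3 (mod 4)`. [folklore] -/
theorem I_pow_of_mod_four (d : ℕ) : (d % 4 = 1 → I ^ d = I) ∧ (d % 4 = 3 → I ^ d = -I) := by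
  have key : I ^ d = I ^ (d % 4) := by
    conv_lhs => rw [← Nat.div_add_mod d 4, pow_add, pow_mul, I_pow_four, one_pow, one_mul]
  refine ⟨fun h => by rw [key, h, pow_one], fun h => by rw [key, h, pow_succ, I_sq]; ring⟩

/-- **`σ(i) = χ₋₄(d)·i`**: `σ i = i` if `d ≡ 1 (mod 4)`, `σ i = −i` if `d ≡ 3 (mod 4)` (`4 ∣ N`, `σ(ζ_N) = ζ_N^d`). [folklore] -/
theorem algEquiv_I_of_mod_four (σ : ℂ ≃ₐ[ℚ] ℂ) {N d : ℕ} (hN : N ≠ 0) (h4 : 4 ∣ N)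
    (hσ : σ (exp (2 * Real.pi * I / N)) = exp (2 * Real.pi * I / N) ^ d) :
    (d % 4 = 1 → σ I = I) ∧ (d % 4 = 3 → σ I = -I) := by
  rw [algEquiv_I_eq_I_pow σ hN h4 hσ]
  exact I_pow_of_mod_four d

/-! ## §3 `σ(√2)` -/

/-- `ζ₈^k = cos(kπ/4) + sin(kπ/4)·i`. [folklore] -/
theorem zeta_eight_pow (k : ℕ) :
    exp (Real.pi / 4 * I) ^ k = ((Real.cos (k * Real.pi / 4) : ℝ) : ℂ) + ((Real.sin (k * Real.pi / 4) : ℝ) : ℂ) * I := by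
  rw [← exp_nat_mul, show (k : ℂ) * (Real.pi / 4 * I) = ((k * Real.pi / 4 : ℝ) : ℂ) * I by push_cast; ring, exp_mul_I,
    ← ofReal_cos, ← ofReal_sin]

/-- `ζ₈ + ζ₈⁷ = √2`. [folklore] -/
theorem zeta_eight_add_pow_seven : exp (Real.pi / 4 * I) + exp (Real.pi / 4 * I) ^ 7 = (Real.sqrt 2 : ℂ) := by
  have h1 := zeta_eight_pow 1
  rw [pow_one] at h1
  rw [zeta_eight_pow 7, h1]
  have hc1 : Real.cos ((1 : ℕ) * Real.pi / 4) = Real.sqrt 2 / 2 := by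
    rw [Nat.cast_one, one_mul]; exact Real.cos_pi_div_four
  have hs1 : Real.sin ((1 : ℕ) * Real.pi / 4) = Real.sqrt 2 / 2 := by
    rw [Nat.cast_one, one_mul]; exact Real.sin_pi_div_four
  have hc7 : Real.cos ((7 : ℕ) * Real.pi / 4) = Real.sqrt 2 / 2 := by
    rw [show ((7 : ℕ) : ℝ) * Real.pi / 4 = 2 * Real.pi - Real.pi / 4 by push_cast; ring, Real.cos_two_pi_sub,
      Real.cos_pi_div_four]
  have hs7 : Real.sin ((7 : ℕ) * Real.pi / 4) = -(Real.sqrt 2 / 2) := by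
    rw [show ((7 : ℕ) : ℝ) * Real.pi / 4 = 2 * Real.pi - Real.pi / 4 by push_cast; ring, Real.sin_two_pi_sub,
      Real.sin_pi_div_four]
  rw [hc1, hs1, hc7, hs7]
  push_cast
  ring

/-- `ζ₈³ + ζ₈⁵ = −√2`. [folklore] -/
theorem zeta_eight_pow_three_add_pow_five :
    exp (Real.pi / 4 * I) ^ 3 + exp (Real.pi / 4 * I) ^ 5 = -(Real.sqrt 2 : ℂ) := by
  rw [zeta_eight_pow 3, zeta_eight_pow 5]
  have hc3 : Real.cos ((3 : ℕ) * Real.pi / 4) = -(Real.sqrt 2 / 2) := by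
    rw [show ((3 : ℕ) : ℝ) * Real.pi / 4 = Real.pi - Real.pi / 4 by push_cast; ring, Real.cos_pi_sub, Real.cos_pi_div_four]
  have hs3 : Real.sin ((3 : ℕ) * Real.pi / 4) = Real.sqrt 2 / 2 := by
    rw [show ((3 : ℕ) : ℝ) * Real.pi / 4 = Real.pi - Real.pi / 4 by push_cast; ring, Real.sin_pi_sub, Real.sin_pi_div_four]
  have hc5 : Real.cos ((5 : ℕ) * Real.pi / 4) = -(Real.sqrt 2 / 2) := by
    rw [show ((5 : ℕ) : ℝ) * Real.pi / 4 = Real.pi / 4 + Real.pi by push_cast; ring, Real.cos_add_pi, Real.cos_pi_div_four]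
  have hs5 : Real.sin ((5 : ℕ) * Real.pi / 4) = -(Real.sqrt 2 / 2) := by
    rw [show ((5 : ℕ) : ℝ) * Real.pi / 4 = Real.pi / 4 + Real.pi by push_cast; ring, Real.sin_add_pi, Real.sin_pi_div_four]
  rw [hc3, hs3, hc5, hs5]
  push_cast
  ring

/-- `ζ₈⁸ = 1`, so `ζ₈^k = ζ₈^{k mod 8}`. [folklore] -/
theorem zeta_eight_pow_mod (k : ℕ) : exp (Real.pi / 4 * I) ^ k = exp (Real.pi / 4 * I) ^ (k % 8) := by
  have h8 : exp (Real.pi / 4 * I) ^ 8 = 1 := by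
    rw [← exp_nat_mul, show ((8 : ℕ) : ℂ) * (Real.pi / 4 * I) = 2 * Real.pi * I by push_cast; ring, exp_two_pi_mul_I]
  conv_lhs => rw [← Nat.div_add_mod k 8, pow_add, pow_mul, h8, one_pow, one_mul]

/-- **Conductor 8: `σ(√2) = χ₈(d)·√2`.**  If `8 ∣ N` and `σ(ζ_N) = ζ_N^d` then `σ(√2) = √2` for `d ≡ ±1 (mod 8)` and
`σ(√2) = −√2` for `d ≡ ±3 (mod 8)`. [folklore] -/
theorem algEquiv_sqrt_two_of_mod_eight (σ : ℂ ≃ₐ[ℚ] ℂ) {N d : ℕ} (hN : N ≠ 0) (h8 : 8 ∣ N)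
    (hσ : σ (exp (2 * Real.pi * I / N)) = exp (2 * Real.pi * I / N) ^ d) :
    ((d % 8 = 1 ∨ d % 8 = 7) → σ (Real.sqrt 2 : ℂ) = Real.sqrt 2) ∧
      ((d % 8 = 3 ∨ d % 8 = 5) → σ (Real.sqrt 2 : ℂ) = -Real.sqrt 2) := by
  obtain ⟨m, rfl⟩ := h8
  have hm : m ≠ 0 := by rintro rfl; exact hN rfl
  have hη := exp_two_pi_I_div_pow_eq_zeta_eight (N := 8 * m) rfl hm
  -- `σ(ζ₈) = ζ₈^d`
  have hση : σ (exp (Real.pi / 4 * I)) = exp (Real.pi / 4 * I) ^ d := by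
    rw [← hη, map_pow, hσ, ← pow_mul, Nat.mul_comm d m, pow_mul]
  -- `σ(√2) = ζ₈^d + ζ₈^{7d}`
  have hσ2 : σ (Real.sqrt 2 : ℂ) = exp (Real.pi / 4 * I) ^ (d % 8) + exp (Real.pi / 4 * I) ^ (7 * d % 8) := by
    rw [← zeta_eight_pow_mod, ← zeta_eight_pow_mod]
    rw [← zeta_eight_add_pow_seven, map_add, map_pow, hση, ← pow_mul, Nat.mul_comm d 7]
  refine ⟨fun h => ?_, fun h => ?_⟩
  · rcases h with h | h
    · rw [hσ2, h, show 7 * d % 8 = 7 by omega, pow_one]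
      exact zeta_eight_add_pow_seven
    · rw [hσ2, h, show 7 * d % 8 = 1 by omega, pow_one, add_comm]
      exact zeta_eight_add_pow_seven
  · rcases h with h | h
    · rw [hσ2, h, show 7 * d % 8 = 5 by omega]
      exact zeta_eight_pow_three_add_pow_five
    · rw [hσ2, h, show 7 * d % 8 = 3 by omega, add_comm]
      exact zeta_eight_pow_three_add_pow_five

end Summit.BirchSwinnertonDyer.BirchSwinnertonDyer.Theorems.ManinLocalTwoThree.ComplexAut

end
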